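import Summits.BirchSwinnertonDyer.BirchSwinnertonDyer.Theorems.KatoDescentTamePotSupersingularJetchevIrreducibleReadingDivisibilityCoreVertexBridgePrimed
import Summits.BirchSwinnertonDyer.BirchSwinnertonDyer.Theorems.KatoDescentTamePotSupersingularJetchevIrreducibleReadingThm52KernelInputsCebotarev
import HarnessLib

/-!
# Route `KatoDescentPotSupersingular` (rung K9, sub-rung B5 O6 wild 3, cell `bsd-potss`): the `q = p` crux
# `WildJetchevBoundAtP` (item 19941) — S2p over the PRIMED readings of 20165 v5 and Thm. 6.3-at-`p` WITHOUT the
# Čebotarev stub (sequel of `…WildJetchevBoundAtPCoreVertexBridge`, p520230; seat `bsd-potss-k9-c4` g8; route-free;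
# `--supports 19941`, helper; nothing booked, no item closed, BSD is not proved by any of this)

WHY A SEQUEL. Between p520230 and now two things moved on the shared crux 20165: (a) k8t-c4 g9 PROVED the Čebotarev
reading on the rows (`JetchevIrreducibleCebotarev.cor32_localOrder_of_irreducible_of_heegner`, p516209) and showed the
displayed `h32I` (no Heegner / `p ∣ N` binder) FALSE (dihedral counterexample N = 6912, p = 3), so skeleton v4 DROPPED
`stub_cor32Irred` and the H63 assembly runs Čebotarev-free (`…Thm52KernelInputsCebotarev`, p519470); (b) planner g22's v5
PRIMES `stub_prop52Irred` / `stub_coreVertexExistenceIrred` with the row binder `(p : ℤ) ∣ W.conductorNorm ℤ`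
(bridge re-issued in `…JetchevIrreducibleReadingDivisibilityCoreVertexBridgePrimed`). This file re-keys 19941's cut on both:

* §1 `divisibilityAtP_of_prop52IrredP_of_coreVertexExistenceIrredP_of_thm63AtP` — S2p (the `hDp` schema of p518161
  VERBATIM) from the PRIMED readings (`Sig.stub_prop52IrredP`, `Sig.stub_coreVertexExistenceIrredP`), `hRCF` and
  `H63Ip` ([J] Thm. 6.3 for the row objects with carrier `p`, as in p520230); `p ∣ N_E` derived from `Addv`.
* §2 `thm63AtP_of_prop44Irred_of_kernelGapsAtP` — `H63Ip` from `h44I` = `stub_prop44Irred` ALONE + the displayed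
  kernel-gaps-at-`p` statement `hKGp` (unchanged from p520230), via k8t-c4 g9's Čebotarev-free assembly
  `tamagawaExponent_le_mInfty_of_kernelInputs_of_irreducible_of_heegner` at `t := ord_p c_p(E)` (Heegner + `p ∣ N_E`
  are row data).

So, in the kernel, matching 20165 v4/v5 slot for slot: **19941 ⟸ S1 ∧ prop52IrredP ∧ coreVertexExistenceIrredP ∧
prop44Irred ∧ KernelGapsAtP ∧ PublishedInputsHeegner (∧ the idle `d_K = −4` supplement)** — every displayed reading is
a registered stub of 20165 except `KernelGapsAtP` (20165's `stub_thm52KernelGapsAddv` with the carrier moved to `p`).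
CONDITIONAL on every displayed input; nothing asserted about any curve; 19941, 20165, their stubs and BSD stay open.

References: [cite: Jetchev2008, Conj. 1.3, Thm. 1.4, Def. 4.8, Prop. 4.9, Thm. 5.1, Thm. 5.2 (p. 821), Prop. 5.3, Rem. 6.2]
[cite: McCallumLMS1991, §3 Cor. 3.2, §4 Prop. 4.4, §5 Prop. 5.2] [cite: GrossLMS1991, §3, Prop. 5.3, Prop. 6.2 (1)]
[cite: GrossZagier1986, III (3.1)] [cite: MilneADT2006, Ch. I Prop. 3.8].
-/

set_option autoImplicit false
-- the Theorems directory repeats the summit name (sibling precedent `KatoDescentPotSupersingularAssembly.lean`)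
set_option linter.dupNamespace false

noncomputable section

open scoped Classical NumberField

open WeierstrassCurve IsDedekindDomain NumberField Literature.NumberTheory.EllipticCurves
  Literature.NumberTheory.EllipticCurves.ModularForms Literature.NumberTheory.EllipticCurves.Jetchev2008
  Literature.NumberTheory.EllipticCurves.Rank1Residual
  Literature.NumberTheory.GaloisRepresentations
  Literature.NumberTheory.GaloisRepresentations.DiscreteGaloisModule
  Summit.BirchSwinnertonDyer.Rank1Residual Summit.BirchSwinnertonDyer.Rank1Residual.X11b
  Summit.BirchSwinnertonDyer.Rank1Residual.JET
  Summit.BirchSwinnertonDyer.BirchSwinnertonDyer.Theorems.JetchevIrreducibleReadingDivisibility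
  Summit.BirchSwinnertonDyer.BirchSwinnertonDyer.Theorems.JetchevIrreducibleReadingDivisibilityPrimed

namespace Summit.BirchSwinnertonDyer.BirchSwinnertonDyer.Theorems.WildJetchevBoundAtPCoreVertexBridgePrimed

/-! ### §1 S2p from the PRIMED readings of McCallum 5.2 / Jetchev 5.3 (20165 v5) + Thm. 6.3 with carrier `p` -/

/-- **S2p (the `hDp` schema of `…WildJetchevBoundAtPOfStubs`, VERBATIM) from the PRIMED readings `h52I` =
`Sig.stub_prop52IrredP`, `hCVI` = `Sig.stub_coreVertexExistenceIrredP` (20165 v5), `hRCF` and `H63Ip`** (as in p520230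
§1). `p ∣ N_E` from `Addv`; bridge `derivedPoint_divisible_of_prop52Row_of_section6_min` fed by
`prop52Row_of_prop52IrredP` / `exists_coreVertex_of_coreVertexExistenceIrredP`. CONDITIONAL; nothing asserted.
[cite: Jetchev2008, Thm. 1.4 (proof, p. 824), Prop. 5.3, Thm. 5.2] [cite: McCallumLMS1991, §5 Prop. 5.2 (p. 304)] -/
theorem divisibilityAtP_of_prop52IrredP_of_coreVertexExistenceIrredP_of_thm63AtP
    (h52I : ∀ (W : WeierstrassCurve ℚ) [W.IsElliptic] [W.IsGloballyMinimal] [NeZero (W.conductorNorm ℤ)],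
        ¬ W.HasCM →
        ∀ (K : Type) [Field K] [NumberField K], IsImaginaryQuadratic K →
        NumberField.discr K ≠ -3 → NumberField.discr K ≠ -4 →
        SatisfiesHeegnerHypothesis (W.conductorNorm ℤ) K →
        ∀ (p : ℕ) [Fact p.Prime], p ≠ 2 → W.HasIrreducibleModPGaloisRep p → (p : ℤ) ∣ W.conductorNorm ℤ →
        ∀ (Dt : ModularParametrizationData W (W.conductorNorm ℤ)) (β : ℤ) (ι : K →+* ℂ)
          (d₁ : KolyvaginHeegnerData Dt β ι 1), ¬ IsOfFinAddOrder d₁.derivedPoint →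
        ∀ (r : ℕ), 0 < r →
        ∀ (Mr : ℕ),
          IsLeast {u : ℕ | ∃ (n : ℕ) (d : KolyvaginHeegnerData Dt β ι n), Squarefree n ∧
              n.primeFactors.card = r ∧
              (∀ ℓ ∈ n.primeFactors, Zhang2014.IsKolyvaginPrime (W.conductorNorm ℤ) W K p ℓ ∧
                u + 1 ≤ Zhang2014.kolyvaginIndex W p ℓ) ∧
              (∃ Q : (W.baseChange (ringClassField K ι n)).toAffine.Point,
                ((p ^ u : ℕ) : ℤ) • Q = d.derivedPoint) ∧
              ¬ ∃ Q : (W.baseChange (ringClassField K ι n)).toAffine.Point,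
                ((p ^ (u + 1) : ℕ) : ℤ) • Q = d.derivedPoint} Mr →
        ∀ (M : ℕ), Mr < M →
          ∃ (n : ℕ) (d : KolyvaginHeegnerData Dt β ι n), Squarefree n ∧ n.primeFactors.card = r ∧
            (∀ ℓ ∈ n.primeFactors, Zhang2014.IsKolyvaginPrime (W.conductorNorm ℤ) W K p ℓ ∧
              M ≤ Zhang2014.kolyvaginIndex W p ℓ) ∧
            addOrderOf (d.kolyvaginClass (Fact.out : p.Prime) M) = p ^ (M - Mr) ∧
            (∃ Q : (W.baseChange (ringClassField K ι n)).toAffine.Point,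
              ((p ^ Mr : ℕ) : ℤ) • Q = d.derivedPoint) ∧
            ¬ ∃ Q : (W.baseChange (ringClassField K ι n)).toAffine.Point,
              ((p ^ (Mr + 1) : ℕ) : ℤ) • Q = d.derivedPoint)
    (hCVI : ∀ (W : WeierstrassCurve ℚ) [W.IsElliptic] [W.IsGloballyMinimal] [NeZero (W.conductorNorm ℤ)],
        ¬ W.HasCM →
        ∀ (K : Type) [Field K] [NumberField K], IsImaginaryQuadratic K →
        NumberField.discr K ≠ -3 → NumberField.discr K ≠ -4 →
        SatisfiesHeegnerHypothesis (W.conductorNorm ℤ) K →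
        ∀ (τ : K ≃ₐ[ℚ] K), τ ≠ 1 →
        ∀ (p : ℕ) [Fact p.Prime], p ≠ 2 → W.HasIrreducibleModPGaloisRep p → (p : ℤ) ∣ W.conductorNorm ℤ →
        ∀ (Dt : ModularParametrizationData W (W.conductorNorm ℤ)) (β : ℤ) (ι : K →+* ℂ)
          [∀ k : ℕ, NumberField (ringClassField K ι k)]
          (d₁ : KolyvaginHeegnerData Dt β ι 1), ¬ IsOfFinAddOrder d₁.derivedPoint →
        ∀ (m : ℕ), 1 ≤ m →
        ∀ (c : ℕ) (d : KolyvaginHeegnerData Dt β ι c), Squarefree c →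
          (∀ ℓ ∈ c.primeFactors, Zhang2014.IsKolyvaginPrime (W.conductorNorm ℤ) W K p ℓ) →
        ∀ (s : ℕ), ¬ IsOfFinAddOrder d.derivedPoint →
          (∃ Q : (W.baseChange (ringClassField K ι c)).toAffine.Point,
            ((p ^ s : ℕ) : ℤ) • Q = d.derivedPoint) →
          (¬ ∃ Q : (W.baseChange (ringClassField K ι c)).toAffine.Point,
            ((p ^ (s + 1) : ℕ) : ℤ) • Q = d.derivedPoint) →
          ((s + m : ℕ) : ℕ∞) ≤ Zhang2014.levelIndex W p c →
          ∃ (c' : ℕ) (d' : KolyvaginHeegnerData Dt β ι c'), Squarefree c' ∧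
            (∀ ℓ ∈ c'.primeFactors, Zhang2014.IsKolyvaginPrime (W.conductorNorm ℤ) W K p ℓ ∧
              m + s ≤ Zhang2014.kolyvaginIndex W p ℓ) ∧
            Jetchev2008.IsGlobalCoreVertex W K ι τ p m c' ∧
            ¬ IsOfFinAddOrder d'.derivedPoint ∧
            ¬ ∃ Q : (W.baseChange (ringClassField K ι c')).toAffine.Point,
              ((p ^ (s + 1) : ℕ) : ℤ) • Q = d'.derivedPoint)
    (hRCF : ∀ (K : Type) [Field K] [NumberField K] (ι : K →+* ℂ), IsImaginaryQuadratic K →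
      ∀ k : ℕ, NumberField (ringClassField K ι k))
    (H63Ip : ∀ (W : WeierstrassCurve ℚ) [W.IsElliptic] [W.IsGloballyMinimal] [NeZero (W.conductorNorm ℤ)],
      ¬ W.HasCM → ∀ (K : Type) [Field K] [NumberField K], IsImaginaryQuadratic K →
      NumberField.discr K ≠ -3 → NumberField.discr K ≠ -4 →
      SatisfiesHeegnerHypothesis (W.conductorNorm ℤ) K →
      ∀ (τ : K ≃ₐ[ℚ] K), τ ≠ 1 →
      ∀ (p : ℕ) [Fact p.Prime], p ≠ 2 → W.analyticRank = 0 → Addv W p → 0 ≤ padicValRat p W.j →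
      W.HasIrreducibleModPGaloisRep p → ¬ (∀ n : ℕ, W.HasSurjectiveModNGaloisRep (p ^ n : ℕ)) →
      (∃ Dt : ModularParametrizationData W (W.conductorNorm ℤ),
        (∀ z ∈ Dt.L.lattice, ∃ w ∈ periodLattice Dt.f, z = (Dt.c : ℂ) * w) ∧ ¬ (p : ℤ) ∣ Dt.c) →
      ∀ (Dt : ModularParametrizationData W (W.conductorNorm ℤ)) (β : ℤ) (ι : K →+* ℂ)
        [∀ k : ℕ, NumberField (ringClassField K ι k)]
        (d₁ : KolyvaginHeegnerData Dt β ι 1), ¬ IsOfFinAddOrder d₁.derivedPoint →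
      ∀ (mdiv m : {c : ℕ // Squarefree c ∧ ∀ ℓ ∈ c.primeFactors,
          Zhang2014.IsKolyvaginPrime (W.conductorNorm ℤ) W K p ℓ} → ℕ∞),
      (∀ c (u : ℕ), (u : ℕ∞) ≤ mdiv c ↔ ∀ d : KolyvaginHeegnerData Dt β ι c.1,
        ∃ Q : (W.baseChange (ringClassField K ι c.1)).toAffine.Point,
          ((p ^ u : ℕ) : ℤ) • Q = d.derivedPoint) →
      (∀ c, m c = if mdiv c < Zhang2014.levelIndex W p c.1 then mdiv c else ⊤) →
      ∀ mInf : ℕ, (∀ c, (mInf : ℕ∞) ≤ m c) →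
        (∀ m' : ℕ, ∃ c, (m' : ℕ∞) ≤ Zhang2014.levelIndex W p c.1 ∧ m c = mInf) →
      ∀ (k : ℕ) c, 1 ≤ k → Jetchev2008.IsGlobalCoreVertex W K ι τ p k c.1 → m c = mInf →
        (k : ℕ∞) + mInf ≤ Zhang2014.levelIndex W p c.1 →
        padicValNat p ((W.baseChange ℚ_[p]).localTamagawaNumber ℤ_[p]) < k → mInf < k →
        padicValNat p ((W.baseChange ℚ_[p]).localTamagawaNumber ℤ_[p]) ≤ mInf) :
    ∀ (W : WeierstrassCurve ℚ) [W.IsElliptic] [W.IsGloballyMinimal] [NeZero (W.conductorNorm ℤ)],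
      ¬ W.HasCM →
      ∀ (K : Type) [Field K] [NumberField K], IsImaginaryQuadratic K →
      NumberField.discr K ≠ -3 → NumberField.discr K ≠ -4 →
      SatisfiesHeegnerHypothesis (W.conductorNorm ℤ) K →
      ∀ (p : ℕ) [Fact p.Prime], p ≠ 2 → W.analyticRank = 0 → Addv W p → 0 ≤ padicValRat p W.j →
      W.HasIrreducibleModPGaloisRep p → ¬ (∀ n : ℕ, W.HasSurjectiveModNGaloisRep (p ^ n : ℕ)) →
      (∃ Dt : ModularParametrizationData W (W.conductorNorm ℤ),
        (∀ z ∈ Dt.L.lattice, ∃ w ∈ periodLattice Dt.f, z = (Dt.c : ℂ) * w) ∧ ¬ (p : ℤ) ∣ Dt.c) →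
      ∀ (Dt : ModularParametrizationData W (W.conductorNorm ℤ)) (β : ℤ) (ι : K →+* ℂ)
        (d₁ : KolyvaginHeegnerData Dt β ι 1), ¬ IsOfFinAddOrder d₁.derivedPoint →
      ∀ (s : ℕ), s ≤ padicValNat p ((W.baseChange ℚ_[p]).localTamagawaNumber ℤ_[p]) →
      ∀ (n : ℕ) (d : KolyvaginHeegnerData Dt β ι n), Squarefree n →
        (∀ ℓ ∈ n.primeFactors, Zhang2014.IsKolyvaginPrime (W.conductorNorm ℤ) W K p ℓ ∧
          s ≤ Zhang2014.kolyvaginIndex W p ℓ) →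
        ∃ Q : (W.baseChange (ringClassField K ι n)).toAffine.Point,
          ((p ^ s : ℕ) : ℤ) • Q = d.derivedPoint := by
  intro W _ _ _ hcm K _ _ hK hD3 hD4 hH p _ hp2 hr hadd hj hirr hns hopt Dt β ι d₁ hy s hs n d hn hℓ
  have hp : p.Prime := Fact.out
  have hpN : p ∣ W.conductorNorm ℤ := (W.dvd_conductorNorm_iff_not_hasGoodReductionAtPrime p).mpr hadd.1
  obtain ⟨τ, hτ⟩ := exists_algEquiv_ne_one_of_isImaginaryQuadratic K hK
  haveI : ∀ k : ℕ, NumberField (ringClassField K ι k) := hRCF K ι hK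
  refine derivedPoint_divisible_of_prop52Row_of_section6_min W K p Dt β ι
    (prop52Row_of_prop52IrredP h52I W hcm K hK hD3 hD4 hH p hp2 hirr hpN Dt β ι d₁ hy) _ ?_ s hs n d hn hℓ
  intro mdiv m hchar hmdef mInf hmInf hKoly
  exact ⟨fun k c ↦ Jetchev2008.IsGlobalCoreVertex W K ι τ p k c.1,
    fun k c hk hmc hMc ↦ exists_coreVertex_of_coreVertexExistenceIrredP hCVI W hcm K hK hD3 hD4 hH τ hτ p hp2
      hirr hpN Dt β ι d₁ hy mdiv m hchar hmdef mInf k c hk hmc hMc,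
    fun k c hk hcore hmc hMc htk hik ↦ H63Ip W hcm K hK hD3 hD4 hH τ hτ p hp2 hr hadd hj hirr hns hopt Dt β ι
      d₁ hy mdiv m hchar hmdef mInf hmInf hKoly k c hk hcore hmc hMc htk hik⟩

/-! ### §2 Thm. 6.3 with carrier `p` for the row objects, Čebotarev-free: from Prop. 4.4 (irreducible reading, shared with 20165) and ONE displayed kernel-gaps statement at the carrier `p` -/

/-- **`H63Ip` ([J] Thm. 6.3 for the row objects, Tamagawa carrier = the additive prime `p`) from `h44I` =
`stub_prop44Irred` (20165, verbatim) and `hKGp`** (the kernel-gaps-at-`p` statement of p520230 §2, unchanged) — NO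
Čebotarev reading: McCallum Cor. 3.2 for the irreducible image is k8t-c4 g9's THEOREM
`JetchevIrreducibleCebotarev.cor32_localOrder_of_irreducible_of_heegner` under the row data Heegner(`N_E`, `K`) +
`p ∣ N_E`, consumed inside `tamagawaExponent_le_mInfty_of_kernelInputs_of_irreducible_of_heegner` (p519470), which this
theorem instantiates at `t := ord_p c_p(E)`. CONDITIONAL; nothing asserted.
[cite: Jetchev2008, Thm. 5.2 (p. 821) and proof, Def. 4.8, Prop. 4.9, Thm. 5.1, Rem. 6.2] [cite: McCallumLMS1991, §3 Cor. 3.2, §4 Prop. 4.4]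
[cite: GrossLMS1991, Prop. 5.3, Prop. 6.2 (1)] [cite: GrossZagier1986, III (3.1)] -/
theorem thm63AtP_of_prop44Irred_of_kernelGapsAtP
    (h44I : ∀ (W : WeierstrassCurve ℚ) [W.IsElliptic] [W.IsGloballyMinimal] [NeZero (W.conductorNorm ℤ)],
        ¬ W.HasCM →
        ∀ (K : Type) [Field K] [NumberField K], IsImaginaryQuadratic K →
        NumberField.discr K ≠ -3 → NumberField.discr K ≠ -4 →
        SatisfiesHeegnerHypothesis (W.conductorNorm ℤ) K →
        ∀ (p : ℕ) [Fact p.Prime], p ≠ 2 → W.HasIrreducibleModPGaloisRep p →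
        ∀ (Dt : ModularParametrizationData W (W.conductorNorm ℤ)) (β : ℤ) (ι : K →+* ℂ)
          (M : ℕ), 1 ≤ M →
        ∀ (m l : ℕ), Squarefree (m * l) → l.Prime → ¬ l ∣ m →
          (∀ l' ∈ (m * l).primeFactors, Zhang2014.IsKolyvaginPrime (W.conductorNorm ℤ) W K p l' ∧
            M ≤ Zhang2014.kolyvaginIndex W p l') →
        ∀ (d : KolyvaginHeegnerData Dt β ι m) (d' : KolyvaginHeegnerData Dt β ι (m * l)),
          (∀ l' ∈ m.primeFactors, ∀ (x : ringClassField K ι m) (x' : ringClassField K ι (m * l)),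
            (x : ℂ) = x' → ((d'.σ l' x' : ringClassField K ι (m * l)) : ℂ) = (d.σ l' x : ℂ)) →
          (∀ s ∈ d.S, ∃ s' ∈ d'.S, ∀ (x : ringClassField K ι m) (x' : ringClassField K ι (m * l)),
            (x : ℂ) = x' → ((s' x' : ringClassField K ι (m * l)) : ℂ) = (s x : ℂ)) →
          (∀ s' ∈ d'.S, ∃ s ∈ d.S, ∀ (x : ringClassField K ι m) (x' : ringClassField K ι (m * l)),
            (x : ℂ) = x' → ((s' x' : ringClassField K ι (m * l)) : ℂ) = (s x : ℂ)) →
          (∀ (x : ringClassField K ι m) (x' : ringClassField K ι (m * l)),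
            (x : ℂ) = x' → d'.emb x' = d.emb x) →
        ∀ (v : HeightOneSpectrum (𝓞 K)), (l : 𝓞 K) ∈ v.asIdeal →
        ∀ (j : ℕ),
          (((p ^ j : ℕ) : ℤ) • d'.kolyvaginClass (Fact.out : p.Prime) M ∈
              selmerLocalKer (W.baseChange K) (v.adicCompletion K) ((p ^ M : ℕ) : ℤ) ↔
            ((p ^ j : ℕ) : ℤ) • d'.kolyvaginClass (Fact.out : p.Prime) M ∈
              (W.baseChange K).torsionLocalKer (v.adicCompletion K) ((p ^ M : ℕ) : ℤ)) ∧
          (((p ^ j : ℕ) : ℤ) • d'.kolyvaginClass (Fact.out : p.Prime) M ∈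
              (W.baseChange K).torsionLocalKer (v.adicCompletion K) ((p ^ M : ℕ) : ℤ) ↔
            ((p ^ j : ℕ) : ℤ) • d.kolyvaginClass (Fact.out : p.Prime) M ∈
              (W.baseChange K).torsionLocalKer (v.adicCompletion K) ((p ^ M : ℕ) : ℤ)))
    (hKGp : ∀ (W : WeierstrassCurve ℚ) [W.IsElliptic] [W.IsGloballyMinimal] [NeZero (W.conductorNorm ℤ)],
      ¬ W.HasCM → ∀ (K : Type) [Field K] [NumberField K], IsImaginaryQuadratic K →
      NumberField.discr K ≠ -3 → NumberField.discr K ≠ -4 →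
      SatisfiesHeegnerHypothesis (W.conductorNorm ℤ) K →
      ∀ (τ : K ≃ₐ[ℚ] K), τ ≠ 1 →
      ∀ (p : ℕ) [Fact p.Prime], p ≠ 2 → W.analyticRank = 0 → Addv W p → 0 ≤ padicValRat p W.j →
      W.HasIrreducibleModPGaloisRep p → ¬ (∀ n : ℕ, W.HasSurjectiveModNGaloisRep (p ^ n : ℕ)) →
      (∃ Dt : ModularParametrizationData W (W.conductorNorm ℤ),
        (∀ z ∈ Dt.L.lattice, ∃ w ∈ periodLattice Dt.f, z = (Dt.c : ℂ) * w) ∧ ¬ (p : ℤ) ∣ Dt.c) →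
      ∀ (Dt : ModularParametrizationData W (W.conductorNorm ℤ)) (β : ℤ) (ι : K →+* ℂ)
        [∀ k : ℕ, NumberField (ringClassField K ι k)]
        (d₁ : KolyvaginHeegnerData Dt β ι 1), ¬ IsOfFinAddOrder d₁.derivedPoint →
      ∀ (mdiv m : {c : ℕ // Squarefree c ∧ ∀ ℓ ∈ c.primeFactors,
          Zhang2014.IsKolyvaginPrime (W.conductorNorm ℤ) W K p ℓ} → ℕ∞),
      (∀ c (u : ℕ), (u : ℕ∞) ≤ mdiv c ↔ ∀ d : KolyvaginHeegnerData Dt β ι c.1,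
        ∃ Q : (W.baseChange (ringClassField K ι c.1)).toAffine.Point,
          ((p ^ u : ℕ) : ℤ) • Q = d.derivedPoint) →
      (∀ c, m c = if mdiv c < Zhang2014.levelIndex W p c.1 then mdiv c else ⊤) →
      ∀ mInf : ℕ, (∀ c, (mInf : ℕ∞) ≤ m c) →
        (∀ m' : ℕ, ∃ c, (m' : ℕ∞) ≤ Zhang2014.levelIndex W p c.1 ∧ m c = mInf) →
      ∀ (k : ℕ) c, 1 ≤ k → Jetchev2008.IsGlobalCoreVertex W K ι τ p k c.1 → m c = mInf →
        (k : ℕ∞) + mInf ≤ Zhang2014.levelIndex W p c.1 →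
        padicValNat p ((W.baseChange ℚ_[p]).localTamagawaNumber ℤ_[p]) < k → mInf < k →
        (phi_heegnerPointOfConductor_mem_range_map_ringClassField (W.conductorNorm ℤ) W K ∧
        exists_generator_ringClassGalOver K ∧
        ∃ (ε : ℤ), (ε = 1 ∨ ε = -1) ∧
          (∀ (m : ℕ) (dm : KolyvaginHeegnerData Dt β ι m)
            (τm : ringClassField K ι m ≃ₐ[ℚ] ringClassField K ι m),
            (∀ x : ringClassField K ι m, ((τm x : ringClassField K ι m) : ℂ) = starRingEnd ℂ x) →
            ∃ σ' ∈ ringClassGal ι m, IsOfFinAddOrder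
            (pointGalHom W (ringClassField K ι m) τm dm.y -
            ε • pointGalHom W (ringClassField K ι m) σ' dm.y)) ∧
          ∃ (n' : ℤ), IsCoprime (p : ℤ) n' ∧
          (∀ (m : ℕ) (dm : KolyvaginHeegnerData Dt β ι m)
            (γ : ringClassField K ι m ≃ₐ[ℚ] ringClassField K ι m), γ ∈ ringClassGal ι m →
            ∀ v : HeightOneSpectrum (𝓞 K), ¬ (W.baseChange K).HasGoodReductionAt v →
            n' • pointsMap (W.baseChange K) (v.adicCompletion K)
            (dm.toGeomPoints (pointGalHom W (ringClassField K ι m) γ dm.y)) ∈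
            E0Receptacle (W.baseChange K) v ∧
            ∀ (ℓ : ℕ), ℓ ∈ m.primeFactors → ∀ (dm' : KolyvaginHeegnerData Dt β ι (m / ℓ))
            (hle : ringClassField K ι (m / ℓ) ≤ ringClassField K ι m),
            n' • pointsMap (W.baseChange K) (v.adicCompletion K)
            (dm.toGeomPoints (pointGalHom W (ringClassField K ι m) γ
            (WeierstrassCurve.Affine.Point.map (W' := W)
            ((RingClassField.inclusion ι hle).restrictScalars ℚ) dm'.y))) ∈
            E0Receptacle (W.baseChange K) v) ∧
          ∃ (𝒯 𝒮 : SelmerStructure ((W.baseChange K).torsionGaloisModule ((p ^ k : ℕ) : ℤ)))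
            (Qcar : Finset (HeightOneSpectrum (𝓞 K))) (e' : ℤ)
            (C' : AddSubgroup (galH1Torsion (W.baseChange K) ((p ^ k : ℕ) : ℤ))),
            (∀ x : galoisCohomology ((W.baseChange K).torsionGaloisModule ((p ^ k : ℕ) : ℤ)) 1,
              (∀ w ∈ placesDividing K c.1,
              galoisCohomology.localization ((W.baseChange K).torsionGaloisModule ((p ^ k : ℕ) : ℤ))
              (Sum.inr w) 1 x ∈ 𝒯 (Sum.inr w)) ↔
              ∀ ℓ ∈ c.1.primeFactors, x ∈ transverseKer W K ι ((p ^ k : ℕ) : ℤ) ℓ) ∧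
            (∀ v, 𝒮 v ≤ (W.baseChange K).kummerSelmerStructure ((p ^ k : ℕ) : ℤ) v) ∧
            Disjoint Qcar (placesDividing K c.1) ∧
            e' = ε * (-1) ^ c.1.primeFactors.card ∧
            C' ≤ signPart W K τ ((p ^ k : ℕ) : ℤ) (-e') ⊤ ∧
            (∀ (d : KolyvaginHeegnerData Dt β ι c.1), ∀ ℓ ∈ c.1.primeFactors,
              (d.kolyvaginClass (Fact.out : p.Prime) k :
              galoisCohomology ((W.baseChange K).torsionGaloisModule ((p ^ k : ℕ) : ℤ)) 1) ∈
              transverseKer W K ι ((p ^ k : ℕ) : ℤ) ℓ) ∧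
            (∃ (Qg Qg' : Type) (_ : AddCommGroup Qg) (_ : AddCommGroup Qg') (_ : Finite Qg')
              (locq : signPart W K τ ((p ^ k : ℕ) : ℤ) (-e')
              (modifiedSelmerGroup W K ι ((p ^ k : ℕ) : ℤ) c.1) →+ Qg)
              (locq' : C' →+ Qg'),
              (∀ x : C', locq' x = 0 ↔ (x : galH1Torsion (W.baseChange K) ((p ^ k : ℕ) : ℤ)) ∈
              signPart W K τ ((p ^ k : ℕ) : ℤ) (-e') (modifiedSelmerGroup W K ι ((p ^ k : ℕ) : ℤ) c.1)) ∧
              Nat.card locq.range * Nat.card locq'.range = Nat.card Qg' ∧ IsAddCyclic Qg' ∧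
              Nat.card Qg' = p ^ padicValNat p ((W.baseChange ℚ_[p]).localTamagawaNumber ℤ_[p])) ∧
            (∀ (ℓ : ℕ), Zhang2014.IsKolyvaginPrime (W.conductorNorm ℤ) W K p ℓ →
              k ≤ Zhang2014.kolyvaginIndex W p ℓ → ℓ ∉ c.1.primeFactors →
              ∀ (d' : KolyvaginHeegnerData Dt β ι (c.1 * ℓ)), ∀ q ∈ Qcar,
              galoisCohomology.localization ((W.baseChange K).torsionGaloisModule ((p ^ k : ℕ) : ℤ))
              (Sum.inr q) 1 (d'.kolyvaginClass (Fact.out : p.Prime) k) ∈ 𝒮 (Sum.inr q)) ∧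
            (∀ (ℓ : ℕ), Zhang2014.IsKolyvaginPrime (W.conductorNorm ℤ) W K p ℓ →
              k ≤ Zhang2014.kolyvaginIndex W p ℓ → ℓ ∉ c.1.primeFactors →
              ∀ (d' : KolyvaginHeegnerData Dt β ι (c.1 * ℓ)), ∀ w ∈ placesDividing K c.1,
              galoisCohomology.localization ((W.baseChange K).torsionGaloisModule ((p ^ k : ℕ) : ℤ))
              (Sum.inr w) 1 (d'.kolyvaginClass (Fact.out : p.Prime) k) ∈ 𝒯 (Sum.inr w)) ∧
            (∀ (ℓ : ℕ), Zhang2014.IsKolyvaginPrime (W.conductorNorm ℤ) W K p ℓ →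
              k ≤ Zhang2014.kolyvaginIndex W p ℓ → ℓ ∉ c.1.primeFactors →
              ∀ (v : HeightOneSpectrum (𝓞 K)), (ℓ : 𝓞 K) ∈ v.asIdeal →
              ∃ (Sg : Type) (_ : AddCommGroup Sg)
              (sing : signPart W K τ ((p ^ k : ℕ) : ℤ) (-e')
              (((selmerF0 W ((p ^ k : ℕ) : ℤ) 𝒯 𝒮 (placesDividing K c.1) Qcar).relaxedAt {v}).selmerGroup) →+ Sg),
              (∀ x, sing x = 0 ↔ (x : galoisCohomology ((W.baseChange K).torsionGaloisModule ((p ^ k : ℕ) : ℤ)) 1) ∈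
              signPart W K τ ((p ^ k : ℕ) : ℤ) (-e')
              ((selmerF0 W ((p ^ k : ℕ) : ℤ) 𝒯 𝒮 (placesDividing K c.1) Qcar).selmerGroup)) ∧
              Nat.card sing.range *
              Nat.card (C'.map (galoisCohomology.localization
              ((W.baseChange K).torsionGaloisModule ((p ^ k : ℕ) : ℤ)) (Sum.inr v) 1 :
              galH1Torsion (W.baseChange K) ((p ^ k : ℕ) : ℤ) →+ _)) = p ^ k)))
    (W : WeierstrassCurve ℚ) [W.IsElliptic] [W.IsGloballyMinimal] [NeZero (W.conductorNorm ℤ)]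
    (hcm : ¬ W.HasCM) (K : Type) [Field K] [NumberField K] (hK : IsImaginaryQuadratic K)
    (hD3 : NumberField.discr K ≠ -3) (hD4 : NumberField.discr K ≠ -4)
    (hH : SatisfiesHeegnerHypothesis (W.conductorNorm ℤ) K)
    (τ : K ≃ₐ[ℚ] K) (hτ : τ ≠ 1)
    (p : ℕ) [Fact p.Prime] (hp2 : p ≠ 2) (hr : W.analyticRank = 0) (hadd : Addv W p)
    (hj : 0 ≤ padicValRat p W.j) (hirr : W.HasIrreducibleModPGaloisRep p)
    (hns : ¬ (∀ n : ℕ, W.HasSurjectiveModNGaloisRep (p ^ n : ℕ)))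
    (hopt : ∃ Dt : ModularParametrizationData W (W.conductorNorm ℤ),
      (∀ z ∈ Dt.L.lattice, ∃ w ∈ periodLattice Dt.f, z = (Dt.c : ℂ) * w) ∧ ¬ (p : ℤ) ∣ Dt.c)
    (Dt : ModularParametrizationData W (W.conductorNorm ℤ)) (β : ℤ) (ι : K →+* ℂ)
    [∀ k : ℕ, NumberField (ringClassField K ι k)]
    (d₁ : KolyvaginHeegnerData Dt β ι 1) (hd₁ : ¬ IsOfFinAddOrder d₁.derivedPoint)
    (mdiv m : {c : ℕ // Squarefree c ∧ ∀ ℓ ∈ c.primeFactors,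
        Zhang2014.IsKolyvaginPrime (W.conductorNorm ℤ) W K p ℓ} → ℕ∞)
    (hmdiv : ∀ c (u : ℕ), (u : ℕ∞) ≤ mdiv c ↔ ∀ d : KolyvaginHeegnerData Dt β ι c.1,
      ∃ Q : (W.baseChange (ringClassField K ι c.1)).toAffine.Point,
        ((p ^ u : ℕ) : ℤ) • Q = d.derivedPoint)
    (hm : ∀ c, m c = if mdiv c < Zhang2014.levelIndex W p c.1 then mdiv c else ⊤)
    (mInf : ℕ) (hmin : ∀ c, (mInf : ℕ∞) ≤ m c)
    (hwit : ∀ m' : ℕ, ∃ c, (m' : ℕ∞) ≤ Zhang2014.levelIndex W p c.1 ∧ m c = mInf)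
    (k : ℕ) (c : {c : ℕ // Squarefree c ∧ ∀ ℓ ∈ c.primeFactors,
        Zhang2014.IsKolyvaginPrime (W.conductorNorm ℤ) W K p ℓ}) (hk : 1 ≤ k)
    (hcore : Jetchev2008.IsGlobalCoreVertex W K ι τ p k c.1) (hmc : m c = mInf)
    (hkM : (k : ℕ∞) + mInf ≤ Zhang2014.levelIndex W p c.1)
    (htk : padicValNat p ((W.baseChange ℚ_[p]).localTamagawaNumber ℤ_[p]) < k) (hik : mInf < k) :
    padicValNat p ((W.baseChange ℚ_[p]).localTamagawaNumber ℤ_[p]) ≤ mInf := by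
  obtain ⟨hCM1, hCM2, ε, hε, h53, n', hcop', hGZ, 𝒯, 𝒮, Qcar, e', C', hT, hS, hQcar, he', hC, htr, hdual_q,
      h49str, h49tr, hdual_ℓ⟩ :=
    hKGp W hcm K hK hD3 hD4 hH τ hτ p hp2 hr hadd hj hirr hns hopt Dt β ι d₁ hd₁ mdiv m hmdiv hm mInf hmin
      hwit k c hk hcore hmc hkM htk hik
  exact JetchevIrreducibleReadingThm52.tamagawaExponent_le_mInfty_of_kernelInputs_of_irreducible_of_heegner h44I W
    hcm K hK hD3 hD4 hH hCM1 hCM2 p hp2 hirr ((W.dvd_conductorNorm_iff_not_hasGoodReductionAtPrime p).mpr hadd.1)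
    Dt β ι τ hτ ε hε h53 hcop' hGZ mdiv m hmdiv hm k c hk hcore mInf hmc hkM _ htk hik 𝒯 𝒮 hT hS Qcar hQcar
    e' he' C' hC htr hdual_q h49str h49tr hdual_ℓ

end Summit.BirchSwinnertonDyer.BirchSwinnertonDyer.Theorems.WildJetchevBoundAtPCoreVertexBridgePrimed

end
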